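/-
Copyright: the b2b-balaban cell (near-miss cell 7), T⁴-continuum fan-out; row NE7b ROUND-2 swarm, seat
t4-ne7b-formalise-leaf-10 (gen 12; row S12o «CONCAVE ENTROPY REPAIR» part (i-c) of `t4/b2b-balaban-t4-ne7b-p1/LEAVES-NE7b.md`,
owner's division R-OWNER-23-15 ∕ journal l.17953; finding F-leaf10g12-1, census `CENSUS-THETA-S12n.md`).
Released under the licence of the surrounding project.
-/
import Summits.QuantumFields.BalabanUV.T4Continuum.Support.HistoryJoinsPlacedEnd
import Summits.QuantumFields.BalabanUV.T4Continuum.Support.HistoryJoinsBudgetPivot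

/-!
# Placed root data WITH A SCALE `Ω` between distance and template size: the distance potential, concave and decoupled
# (row S12o part (i-c))

Summits-side support leaf of the T⁴-continuum cell (rung (B)+1 on a FINITE torus only; NOT infinite volume, NOT the
mass gap, NOT the Clay statement; NOT a proof of the spine estimate NE7b).  Row NE7b, route «COUNT», row S12o
«CONCAVE ENTROPY REPAIR» (owner R-OWNER-23-15), part (i-c) «the distance potential, concave and decoupled».
[folklore] SIBLING of leaf-05 gen 3's `HistoryJoinsPlaced` (§1–§2) and `HistoryJoinsPlacedEnd.MρP_placed_le_exp` (§1)
over the SAME generic count (`HistoryJoinsCount` ∕ `…Budget` ∕ `…Nonhost`: `near : β → ℕ → γ → ℕ → ℝ → Prop`,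
`NZ : ℝ → ℕ → ℕ → ℕ`, `ext : ℕ → Gen ε → ℝ` UNCHANGED); nothing is quoted from print, nothing printed is asserted, no
`[cite:]` tag, no `Prop` fact minted (`nearPΩ` is a decidable predicate with parameters, the Ω-twin of `nearP`), no
constant of print; touches no existing file.

WHY (census F7, F-leaf10g12-1).  In `HistoryJoinsPlaced.nearP u t (y,T) s r := nearD … r ∧ tsz T ≤ r + 1` the ANCHOR
DISTANCE and the ROOT-TEMPLATE SIZE share one radius, so the one-block count `NZP′ A r t s = NZD r t s · A (⌊r⌋₊ + 1)`
charges the template entropy `d₁ = 2·log(2d+1)` per unit of DISTANCE radius; with the cyclic-distance law the radius is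
the class-linear potential `ρℓ·(zmass + γ′)` (up to `1.9·10²⁶` per unit class at d = 4, L = 13, collar 32), and together
with `(2⌊r⌋₊+1)^d ≤ e^{2dr}` (`MρT_le_exp`) this is 99.88 % of the count's constant `Θ = 2.36·10²⁷`.  THE DEVICE: a scale
`Ω > 0` inside the nearness — `Ω·(tsz T − 1) ≤ r` — so that `A` is read at `⌊r∕Ω⌋₊ + 1`, plus the tangent line of `log`
at a pivot `ρ₀` for the anchor factor; the radius factor is then of exponential type with the SLOPE
`2d∕(2ρ₀+1) + d₁∕Ω` instead of `2d + d₁`, and the tree's own `HistoryJoinsNonhost.MρP_le_exp_of_nonhost_law` sums it.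

WHAT.
* §1 **`nearPΩ`**, **`radPΩ`** (witness radius `max (cdist …) (Ω·(tsz − 1))`), `nearPΩ_iff`, `nearPΩ_mono`,
  **`nearPΩ_of_scale`** (the END's `hnearW`), `radPΩ_nonneg`, `cdist_le_radPΩ`, `tszΩ_le_radPΩ`, **`radPΩ_le_add`**
  (`radPΩ ≤ cdist + Ω·(tsz − 1)` — the radius law splits into the distance law and the root-template law),
  `tsz_le_floor_div_add_one` (`Ω(tsz−1) ≤ r ⇒ tsz ≤ ⌊r∕Ω⌋₊ + 1`), **`card_nearPΩ_le`** (the END's `hNZ`), `nearPΩ_one`.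
* §2 **`NZPΩ′`**, **`MρPΩ′`** (`MρT d r · A (⌊r∕Ω⌋₊ + 1)`), **`NZPΩ′_le`** (the END's `hNZle`, `Λ := L^d`),
  **`MρPΩ′_le_exp_pivot`**: `MρPΩ′ ≤ exp((a₁ + d₁ + d·log(2ρ₀+1)) + (2d∕(2ρ₀+1) + d₁∕Ω)·r)` (`0 ≤ r`, `0 ≤ ρ₀`, `0 < Ω`),
  `MρPΩ′_one` (`Ω = 1` is today's `MρP′`).
* §3 **`MρP_placedΩ_le_exp`** — the twin of `MρP_placed_le_exp`: under the per-placement radius law for `radPΩ` at the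
  NON-HOST parts with potential `φ` (`radPΩ ≤ C₀·φ + c₉`) of class-linear total `≤ κφ·F`:
  `MρP st (extsup … (radPΩ …)) (MρPΩ′ d Ω A) G ≤ exp((2(a′ + d′c₉) + d′·C₀·κφ)·F)`, `a′ = a₁ + d₁ + d·log(2ρ₀+1)`,
  `d′ = 2d∕(2ρ₀+1) + d₁∕Ω`; and **`MρP_placedΩ_le_exp_natural`** — at the pivots `ρ₀ := C₀κφ + c₉`, `Ω := C₀κφ + c₉ + 1`:
  `≤ exp((2a₁ + 4d₁ + 2d + 2d·log(2(C₀κφ + c₉) + 1))·F)` — the class-linear distance constant is LOGARITHMIC in the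
  potential's total (census: ≈ 5·10² at the letters of record instead of 2.35·10²⁷).
* §4 sanity (decided ∕ `rfl`).
INTERFACE for part (ii) (leaf-05 g10, `HistoryJoinsPlacedEndConcave` …): `near := nearPΩ n L K lv tsz Ω`,
`δ := radPΩ n L K lv tsz Ω`, `NZ := NZPΩ′ d L lv Ω A`, `Mρ := MρPΩ′ d Ω A`, `hnearW := nearPΩ_of_scale`,
`hmono := nearPΩ_mono`, `hNZ := card_nearPΩ_le`, `hNZle := NZPΩ′_le`, `hMρP := MρP_placedΩ_le_exp(_natural)`; the
radius law `hlawR` is assembled from the cyclic-distance law and the root-template law through `radPΩ_le_add` with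
`φΩ t P := ρℓ·zmass t P + Ω·κT·(fat (root P) + 1)` (`C₀ := 1`, `c₉ := ρℓ·γ′`).

HONEST SCOPE.  Bookkeeping over OUR carriers; the END of record, its letter `Θ`, the socket shape `θ·birthLinT`, the
exits, `HistoryConstants*`, every displayed hypothesis and the headline's Prop are untouched (wiring = part (ii)); only
the size of the ∃-bound coupling threshold can move.  NE7b NOT proved; spine 0∕9.  HONEST DEPENDENCY (cell): continuum
YM on T⁴ ⇐ BetaPertH ∧ nine spine estimates (0/9 proved); BetaPertH ⇐ (D1) ∧ (D4) ∧ CAP+tail; G-an2-4 gates asym, D1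
and NE2/3/4.  This file changes none of it.
-/

open Finset
open Literature.MathematicalPhysics.QuantumFieldTheory.Balaban1983to89
open T4PersistenceDictionary T4PartnerMultiplicity T4BranchingRecordsGas
open Summit.QuantumFields.BalabanUV.T4Continuum.HistoryJoins
open Summit.QuantumFields.BalabanUV.T4Continuum.HistoryJoinsAdm
open Summit.QuantumFields.BalabanUV.T4Continuum.HistoryJoinsBudget
open Summit.QuantumFields.BalabanUV.T4Continuum.HistoryJoinsSup
open Summit.QuantumFields.BalabanUV.T4Continuum.HistoryJoinsSupTorus
open Summit.QuantumFields.BalabanUV.T4Continuum.HistoryJoinsRadius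
open Summit.QuantumFields.BalabanUV.T4Continuum.HistoryJoinsNonhost
open Summit.QuantumFields.BalabanUV.T4Continuum.HistoryJoinsPlaced
open Summit.QuantumFields.BalabanUV.T4Continuum.HistoryJoinsBudgetPivot
open Summit.QuantumFields.BalabanUV.T4Continuum.ZoneTorus
open Summit.QuantumFields.BalabanUV.T4Continuum.ZoneSkeleton
open Summit.QuantumFields.BalabanUV.T4Continuum.HistoryZones
open Summit.QuantumFields.BalabanUV.T4Continuum.HistoryMassPlacement
open Summit.QuantumFields.BalabanUV.T4Continuum.HistoryZoneMassJoins

namespace Summit.QuantumFields.BalabanUV.T4Continuum.HistoryJoinsPlacedOmega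

noncomputable section

open scoped Classical

/-! ## §1 The scaled nearness relation and its witness radius -/

section Near

variable {d : ℕ} (n L K : ℕ) (lv : ℕ → ℕ) {Tm : Type*} (tsz : Tm → ℕ) (Ω : ℝ)

/-- **NEARNESS OF A ROOT DATUM WITH SCALE `Ω`**: the cell is near the block at levels (`nearD`) AND the template's
excess size, SCALED BY `Ω`, is within the radius: `Ω·(tsz T − 1) ≤ r`.  At `Ω = 1` this is `HistoryJoinsPlaced.nearP`.
[folklore] -/
def nearPΩ : (Fin d → ℕ) → ℕ → TCell d (n * L ^ K) × Tm → ℕ → ℝ → Prop := fun u t yT s r =>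
  nearD n L K lv u t yT.1 s r ∧ Ω * ((tsz yT.2 : ℝ) - 1) ≤ r

/-- **THE SCALED WITNESS RADIUS** of a block against a root datum: the cyclic sup-distance to the cell's level-`lv t`
block, or `Ω` times the template's excess size, whichever is larger. [folklore] -/
def radPΩ : (Fin d → ℕ) → ℕ → TCell d (n * L ^ K) × Tm → ℕ → ℝ := fun u t yT _ =>
  max ((cdist (n * L ^ (K - lv t)) u (blk L (lv t) yT.1) : ℕ) : ℝ) (Ω * ((tsz yT.2 : ℝ) - 1))

/-- unfolding `nearPΩ` [folklore] -/
theorem nearPΩ_iff (u : Fin d → ℕ) (t : ℕ) (yT : TCell d (n * L ^ K) × Tm) (s : ℕ) (r : ℝ) :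
    nearPΩ n L K lv tsz Ω u t yT s r ↔ nearD n L K lv u t yT.1 s r ∧ Ω * ((tsz yT.2 : ℝ) - 1) ≤ r := Iff.rfl

/-- unfolding `radPΩ` [folklore] -/
theorem radPΩ_apply (u : Fin d → ℕ) (t : ℕ) (yT : TCell d (n * L ^ K) × Tm) (s : ℕ) :
    radPΩ n L K lv tsz Ω u t yT s =
      max ((cdist (n * L ^ (K - lv t)) u (blk L (lv t) yT.1) : ℕ) : ℝ) (Ω * ((tsz yT.2 : ℝ) - 1)) := rfl

/-- `nearPΩ` is monotone in the radius (the END's `hmono`) [folklore] -/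
theorem nearPΩ_mono (u : Fin d → ℕ) (t : ℕ) (yT : TCell d (n * L ^ K) × Tm) (s : ℕ) (r r' : ℝ)
    (h : nearPΩ n L K lv tsz Ω u t yT s r) (hr : r ≤ r') : nearPΩ n L K lv tsz Ω u t yT s r' :=
  ⟨nearD_mono n L K lv u t yT.1 s r r' h.1 hr, h.2.trans hr⟩

/-- **THE READING FACT `hnearW`**: a block in range at level `lv t ≤ K` is near a root datum whose cell has scale `lv s`
at the scaled witness radius `radPΩ`. [folklore] -/
theorem nearPΩ_of_scale {t s : ℕ} {u : Fin d → ℕ} {yT : TCell d (n * L ^ K) × Tm} (htK : lv t ≤ K)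
    (hy : IsScale L (lv s) yT.1) (hu : ∀ i, u i < n * L ^ (K - lv t)) :
    nearPΩ n L K lv tsz Ω u t yT s (radPΩ n L K lv tsz Ω u t yT s) :=
  ⟨nearD_mono n L K lv u t yT.1 s _ _ (nearD_of_scale htK hy hu) (le_max_left _ _), le_max_right _ _⟩

/-- the scaled witness radius is nonnegative [folklore] -/
theorem radPΩ_nonneg (u : Fin d → ℕ) (t : ℕ) (yT : TCell d (n * L ^ K) × Tm) (s : ℕ) :
    0 ≤ radPΩ n L K lv tsz Ω u t yT s :=
  le_trans (Nat.cast_nonneg _) (le_max_left _ _)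

/-- the cyclic distance is below the scaled witness radius [folklore] -/
theorem cdist_le_radPΩ (u : Fin d → ℕ) (t : ℕ) (yT : TCell d (n * L ^ K) × Tm) (s : ℕ) :
    ((cdist (n * L ^ (K - lv t)) u (blk L (lv t) yT.1) : ℕ) : ℝ) ≤ radPΩ n L K lv tsz Ω u t yT s := le_max_left _ _

/-- the scaled excess size is below the scaled witness radius [folklore] -/
theorem tszΩ_le_radPΩ (u : Fin d → ℕ) (t : ℕ) (yT : TCell d (n * L ^ K) × Tm) (s : ℕ) :
    Ω * ((tsz yT.2 : ℝ) - 1) ≤ radPΩ n L K lv tsz Ω u t yT s := le_max_right _ _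

/-- **THE RADIUS LAW SPLITS**: for a template of size `≥ 1` and `Ω ≥ 0`, `radPΩ ≤ cdist + Ω·(tsz − 1)` — so a
cyclic-distance law and a root-template law add up to a radius law. [folklore] -/
theorem radPΩ_le_add (hΩ : 0 ≤ Ω) (u : Fin d → ℕ) (t : ℕ) (yT : TCell d (n * L ^ K) × Tm) (s : ℕ)
    (hT : 1 ≤ tsz yT.2) :
    radPΩ n L K lv tsz Ω u t yT s ≤
      ((cdist (n * L ^ (K - lv t)) u (blk L (lv t) yT.1) : ℕ) : ℝ) + Ω * ((tsz yT.2 : ℝ) - 1) := by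
  have h1 : (0 : ℝ) ≤ ((cdist (n * L ^ (K - lv t)) u (blk L (lv t) yT.1) : ℕ) : ℝ) := Nat.cast_nonneg _
  have hT' : (1 : ℝ) ≤ tsz yT.2 := by exact_mod_cast hT
  have h2 : 0 ≤ Ω * ((tsz yT.2 : ℝ) - 1) := mul_nonneg hΩ (by linarith)
  rw [radPΩ_apply]
  exact max_le (by linarith) (by linarith)

/-- the size clause of the scaled nearness bounds the template size by `⌊r∕Ω⌋₊ + 1` (`Ω > 0`) [folklore] -/
theorem tsz_le_floor_div_add_one (hΩ : 0 < Ω) {k : ℕ} {r : ℝ} (h : Ω * ((k : ℝ) - 1) ≤ r) : k ≤ ⌊r / Ω⌋₊ + 1 := by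
  refine le_floor_add_one_of_le ?_
  have h1 : (k : ℝ) - 1 ≤ r / Ω := by
    rw [le_div_iff₀ hΩ]; linarith [mul_comm Ω ((k : ℝ) - 1)]
  linarith

/-- at `Ω = 1` the scaled nearness is `HistoryJoinsPlaced.nearP` [folklore] -/
theorem nearPΩ_one (u : Fin d → ℕ) (t : ℕ) (yT : TCell d (n * L ^ K) × Tm) (s : ℕ) (r : ℝ) :
    nearPΩ n L K lv tsz 1 u t yT s r ↔ nearP n L K lv tsz u t yT s r := by
  rw [nearPΩ_iff, nearP_iff, one_mul]
  constructor
  · rintro ⟨h1, h2⟩; exact ⟨h1, by linarith⟩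
  · rintro ⟨h1, h2⟩; exact ⟨h1, by linarith⟩

/-- **`hNZ` FOR SCALED ROOT DATA**: `#{(y, T) | nearPΩ u t (y, T) s r} ≤ NZD d L lv r t s · A (⌊r∕Ω⌋₊ + 1)`, given the
template count `#{T | tsz T ≤ m} ≤ A m` and `Ω > 0`. [folklore] -/
theorem card_nearPΩ_le [Fintype Tm] (hL : 1 ≤ L) (hΩ : 0 < Ω) {A : ℕ → ℕ}
    (hA : ∀ m : ℕ, ((univ : Finset Tm).filter fun T => tsz T ≤ m).card ≤ A m)
    (u : Fin d → ℕ) (t s : ℕ) (r : ℝ) :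
    ((univ : Finset (TCell d (n * L ^ K) × Tm)).filter fun yT => nearPΩ n L K lv tsz Ω u t yT s r).card ≤
      NZD d L lv r t s * A (⌊r / Ω⌋₊ + 1) := by
  have hsub : ((univ : Finset (TCell d (n * L ^ K) × Tm)).filter fun yT => nearPΩ n L K lv tsz Ω u t yT s r) ⊆
      ((univ : Finset (TCell d (n * L ^ K))).filter fun y => nearD n L K lv u t y s r) ×ˢ
        ((univ : Finset Tm).filter fun T => tsz T ≤ ⌊r / Ω⌋₊ + 1) := by
    intro yT h
    rw [mem_filter] at h
    rw [mem_product, mem_filter, mem_filter]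
    exact ⟨⟨mem_univ _, h.2.1⟩, ⟨mem_univ _, tsz_le_floor_div_add_one Ω hΩ h.2.2⟩⟩
  refine (card_le_card hsub).trans ?_
  rw [card_product]
  exact Nat.mul_le_mul (card_nearD_le n hL K lv u t s r) (hA _)

end Near

/-! ## §2 The scaled one-block count of root data and its exponential type AT A PIVOT -/

section Count

variable (d L : ℕ) (lv : ℕ → ℕ) (Ω : ℝ)

/-- **THE SCALED ONE-BLOCK ROOT-DATUM COUNT**: cells near the block (`NZD`) times templates of size `≤ ⌊r∕Ω⌋₊ + 1`.
[folklore] -/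
def NZPΩ' (A : ℕ → ℕ) (r : ℝ) (t s : ℕ) : ℕ := NZD d L lv r t s * A (⌊r / Ω⌋₊ + 1)

/-- **THE SCALED RADIUS FACTOR OF ROOT DATA**: `MρT d r · A (⌊r∕Ω⌋₊ + 1)`. [folklore] -/
def MρPΩ' (A : ℕ → ℕ) (r : ℝ) : ℝ := MρT d r * (A (⌊r / Ω⌋₊ + 1) : ℝ)

variable {d L lv Ω}

/-- unfolding `NZPΩ'` [folklore] -/
theorem NZPΩ'_apply (A : ℕ → ℕ) (r : ℝ) (t s : ℕ) :
    NZPΩ' d L lv Ω A r t s = NZD d L lv r t s * A (⌊r / Ω⌋₊ + 1) := rfl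

/-- the scaled radius factor is nonnegative [folklore] -/
theorem MρPΩ'_nonneg (A : ℕ → ℕ) (r : ℝ) : 0 ≤ MρPΩ' d Ω A r := mul_nonneg (MρT_nonneg d r) (Nat.cast_nonneg _)

/-- at `Ω = 1` the scaled radius factor is `HistoryJoinsPlaced.MρP'` [folklore] -/
theorem MρPΩ'_one (A : ℕ → ℕ) (r : ℝ) : MρPΩ' d 1 A r = MρP' d A r := by
  unfold MρPΩ' MρP'; rw [div_one]

/-- **`hNZle` FOR SCALED ROOT DATA**: `NZPΩ' ≤ MρPΩ' · (L^d)^{t+1−s}` under a level function. [folklore] -/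
theorem NZPΩ'_le {K : ℕ} (hlv : HistoryZones.LevelFn K lv) (hL : 1 ≤ L) (A : ℕ → ℕ) (r : ℝ) (t s : ℕ) :
    (NZPΩ' d L lv Ω A r t s : ℝ) ≤ MρPΩ' d Ω A r * ((L : ℝ) ^ d) ^ (t + 1 - s) := by
  unfold NZPΩ' MρPΩ'
  push_cast
  have h1 := NZD_le hlv hL d r t s
  have hA : (0 : ℝ) ≤ A (⌊r / Ω⌋₊ + 1) := Nat.cast_nonneg _
  calc (NZD d L lv r t s : ℝ) * (A (⌊r / Ω⌋₊ + 1) : ℝ) ≤ MρT d r * ((L : ℝ) ^ d) ^ (t + 1 - s) * A (⌊r / Ω⌋₊ + 1) :=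
        mul_le_mul_of_nonneg_right h1 hA
    _ = MρT d r * (A (⌊r / Ω⌋₊ + 1) : ℝ) * ((L : ℝ) ^ d) ^ (t + 1 - s) := by ring

/-- the anchor factor is at least `1` [folklore] -/
theorem one_le_MρT (d : ℕ) (r : ℝ) : 1 ≤ MρT d r := by
  unfold MρT
  exact one_le_pow₀ (by have : (0 : ℝ) ≤ (⌊r⌋₊ : ℕ) := Nat.cast_nonneg _; linarith)

/-- **THE ANCHOR FACTOR AT A PIVOT**: `MρT d r ≤ exp(d·log(2ρ₀+1) + (2d∕(2ρ₀+1))·r)` for `0 ≤ r`, `0 ≤ ρ₀` — the tangent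
line of `log` at `2ρ₀ + 1` (`HistoryJoinsBudgetPivot.mul_log_le_pivot`) in place of `MρT_le_exp`'s `1 + x ≤ e^x`.
[folklore] -/
theorem MρT_le_exp_pivot (d : ℕ) {r ρ₀ : ℝ} (hr : 0 ≤ r) (hρ : 0 ≤ ρ₀) :
    MρT d r ≤ Real.exp ((d : ℝ) * Real.log (2 * ρ₀ + 1) + 2 * (d : ℝ) / (2 * ρ₀ + 1) * r) := by
  have hpos : 0 < MρT d r := lt_of_lt_of_le one_pos (one_le_MρT d r)
  rw [← Real.exp_log hpos]
  have h1 := log_MρT_le d hr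
  have h2 := mul_log_le_pivot d hr hρ
  have h2ρ : (0 : ℝ) < 2 * ρ₀ + 1 := by linarith
  have hsplit : (d : ℝ) * (2 * (r - ρ₀) / (2 * ρ₀ + 1)) =
      2 * (d : ℝ) / (2 * ρ₀ + 1) * r - 2 * (d : ℝ) / (2 * ρ₀ + 1) * ρ₀ := by
    simp only [div_eq_mul_inv]; ring
  have hdrop : 0 ≤ 2 * (d : ℝ) / (2 * ρ₀ + 1) * ρ₀ := by positivity
  exact Real.exp_le_exp.2 (by linarith)

/-- **THE SCALED RADIUS FACTOR IS OF EXPONENTIAL TYPE WITH A SMALL SLOPE**: if the template count is exponential in the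
size, `A m ≤ exp(a₁ + d₁·m)` (`d₁ ≥ 0`), then for every pivot `ρ₀ ≥ 0` and scale `Ω > 0`,
`MρPΩ' d Ω A r ≤ exp((a₁ + d₁ + d·log(2ρ₀+1)) + (2d∕(2ρ₀+1) + d₁∕Ω)·r)` for `r ≥ 0`. [folklore] -/
theorem MρPΩ'_le_exp_pivot {A : ℕ → ℕ} {a₁ d₁ : ℝ} (hd : 0 ≤ d₁)
    (hAexp : ∀ m : ℕ, (A m : ℝ) ≤ Real.exp (a₁ + d₁ * m)) (hΩ : 0 < Ω) {ρ₀ : ℝ} (hρ : 0 ≤ ρ₀) {r : ℝ} (hr : 0 ≤ r) :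
    MρPΩ' d Ω A r ≤
      Real.exp ((a₁ + d₁ + (d : ℝ) * Real.log (2 * ρ₀ + 1)) + (2 * (d : ℝ) / (2 * ρ₀ + 1) + d₁ / Ω) * r) := by
  unfold MρPΩ'
  have h1 := MρT_le_exp_pivot d hr hρ
  have h2 := hAexp (⌊r / Ω⌋₊ + 1)
  have hrΩ : 0 ≤ r / Ω := div_nonneg hr hΩ.le
  have hfl : ((⌊r / Ω⌋₊ + 1 : ℕ) : ℝ) ≤ r / Ω + 1 := by push_cast; linarith [Nat.floor_le hrΩ]
  have h3 : Real.exp (a₁ + d₁ * ((⌊r / Ω⌋₊ + 1 : ℕ) : ℝ)) ≤ Real.exp (a₁ + d₁ * (r / Ω + 1)) :=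
    Real.exp_le_exp.2 (by nlinarith)
  calc MρT d r * (A (⌊r / Ω⌋₊ + 1) : ℝ)
      ≤ Real.exp ((d : ℝ) * Real.log (2 * ρ₀ + 1) + 2 * (d : ℝ) / (2 * ρ₀ + 1) * r) *
          Real.exp (a₁ + d₁ * (r / Ω + 1)) :=
        mul_le_mul h1 (h2.trans h3) (Nat.cast_nonneg _) (Real.exp_pos _).le
    _ = Real.exp ((a₁ + d₁ + (d : ℝ) * Real.log (2 * ρ₀ + 1)) + (2 * (d : ℝ) / (2 * ρ₀ + 1) + d₁ / Ω) * r) := by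
        rw [← Real.exp_add]
        congr 1
        rw [div_eq_mul_inv r Ω]
        ring

end Count

/-! ## §3 The radius-factor product for scaled placed root data: the concave, decoupled distance constant -/

section Placed

variable {ε R Tm : Type*} [DecidableEq ε] [LinearOrder R] [Fintype Tm] {d n L K D : ℕ} (sh : ε → PEv)
  (lv : ℕ → ℕ) (tsz : Tm → ℕ) (Ω : ℝ)
  (zone : ℕ → Gen ε → (Addr D → TCell d (n * L ^ K) × Tm) → Finset (Fin d → ℕ))
  (ρ : (Addr D → TCell d (n * L ^ K) × Tm) → R) (c₀ : TCell d (n * L ^ K) × Tm)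

omit [DecidableEq ε] in
/-- **THE RADIUS-FACTOR PRODUCT FOR SCALED PLACED ROOT DATA, AT A PIVOT**: under the per-placement radius law for
`radPΩ` displayed at the NON-HOST parts with an abstract potential of class-linear total,
`MρP ≤ exp((2(a′ + d′c₉) + d′·C₀·κφ)·F)` with `a′ = a₁ + d₁ + d·log(2ρ₀+1)`, `d′ = 2d∕(2ρ₀+1) + d₁∕Ω` — the twin of
`HistoryJoinsPlacedEnd.MρP_placed_le_exp` (there: `a′ = a₁ + d₁`, `d′ = 2d + d₁`). [folklore] -/
theorem MρP_placedΩ_le_exp {A : ℕ → ℕ} {a₁ d₁ : ℝ} (ha : 0 ≤ a₁) (hd : 0 ≤ d₁)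
    (hAexp : ∀ m : ℕ, (A m : ℝ) ≤ Real.exp (a₁ + d₁ * m)) (hΩ : 0 < Ω) {ρ₀ : ℝ} (hρ : 0 ≤ ρ₀)
    {C₀ c₉ : ℝ} (hC₀ : 0 ≤ C₀) (hc₉ : 0 ≤ c₉) (φ : ℕ → Gen ε → ℝ) (hφ0 : ∀ t P, 0 ≤ φ t P) (G : Gen ε)
    (hlawR : ∀ (X Y : Gen ε) (e : ε), Gen.merge X Y e ∈ joins (PEv.step ∘ sh) G →
      ∀ i, i ≠ hostIdx (PEv.step ∘ sh) X Y e →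
        ∀ p ∈ Sany zone ρ c₀ (PEv.step ∘ sh) (part (PEv.step ∘ sh) (Gen.merge X Y e) i).2,
          ∀ u ∈ zone (sh e).step (part (PEv.step ∘ sh) (Gen.merge X Y e) i).2 p,
            radPΩ n L K lv tsz Ω u (sh e).step (evalA c₀ p (rootAddr (part (PEv.step ∘ sh) (Gen.merge X Y e) i).2))
                (part (PEv.step ∘ sh) (Gen.merge X Y e) i).2.rootStep ≤
              C₀ * φ (sh e).step (part (PEv.step ∘ sh) (Gen.merge X Y e) i).2 + c₉)
    {κφ : ℝ}
    (hΦ : ((joins (PEv.step ∘ sh) G).map fun X => nhsum (PEv.step ∘ sh) (φ (ftime (PEv.step ∘ sh) X)) X).sum ≤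
      κφ * bsum (fun b => (((sh b).fat : ℕ) : ℝ) + 1) G) :
    MρP (PEv.step ∘ sh) (extsup zone ρ c₀ (PEv.step ∘ sh) (radPΩ n L K lv tsz Ω)) (MρPΩ' d Ω A) G ≤
      Real.exp ((2 * ((a₁ + d₁ + (d : ℝ) * Real.log (2 * ρ₀ + 1)) +
            (2 * (d : ℝ) / (2 * ρ₀ + 1) + d₁ / Ω) * c₉) +
          (2 * (d : ℝ) / (2 * ρ₀ + 1) + d₁ / Ω) * C₀ * κφ) *
        bsum (fun b => (((sh b).fat : ℕ) : ℝ) + 1) G) := by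
  set st := PEv.step ∘ sh
  set F := bsum (fun b => (((sh b).fat : ℕ) : ℝ) + 1) G
  set a' : ℝ := a₁ + d₁ + (d : ℝ) * Real.log (2 * ρ₀ + 1) with ha'_def
  set d' : ℝ := 2 * (d : ℝ) / (2 * ρ₀ + 1) + d₁ / Ω with hd'_def
  have hlog : 0 ≤ Real.log (2 * ρ₀ + 1) := Real.log_nonneg (by linarith)
  have ha' : 0 ≤ a' := by rw [ha'_def]; positivity
  have h2ρ : (0 : ℝ) < 2 * ρ₀ + 1 := by linarith
  have hd' : 0 ≤ d' := by rw [hd'_def]; positivity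
  have h := MρP_le_exp_of_nonhost_law st (extsup zone ρ c₀ st (radPΩ n L K lv tsz Ω)) (MρPΩ' d Ω A) ha' hd'
    (fun r => MρPΩ'_nonneg A r) (fun r hr => MρPΩ'_le_exp_pivot (d := d) hd hAexp hΩ hρ hr)
    (fun t P => extsup_nonneg zone ρ c₀ st _ t P) hC₀ hc₉ φ G
    (fun X Y e hX i hi => extsup_le_of_forall zone ρ c₀ st (radPΩ n L K lv tsz Ω)
      (add_nonneg (mul_nonneg hC₀ (hφ0 _ _)) hc₉) (hlawR X Y e hX i hi)) le_rfl
  refine h.trans (Real.exp_le_exp.2 ?_)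
  have hn : (nmerges G : ℝ) + 1 ≤ F := nmerges_lt_bsum sh G
  have hn0 : (0 : ℝ) ≤ nmerges G := Nat.cast_nonneg _
  have hac : 0 ≤ a' + d' * c₉ := by positivity
  have hdC : 0 ≤ d' * C₀ := by positivity
  have h1 : (a' + d' * c₉) * (2 * (nmerges G : ℝ)) ≤ 2 * (a' + d' * c₉) * F := by nlinarith
  have h2 : d' * C₀ * ((joins st G).map fun X => nhsum st (φ (ftime st X)) X).sum ≤ d' * C₀ * κφ * F := by
    have := mul_le_mul_of_nonneg_left hΦ hdC
    linarith [this]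
  linarith

omit [DecidableEq ε] in
/-- **THE NATURAL PIVOTS**: with `Rt := C₀·κφ + c₉` (the potential's class-linear total per unit class), the pivot
`ρ₀ := Rt` and the scale `Ω := Rt + 1` give the distance constant
`κρΩ ≤ 2a₁ + 4d₁ + 2d + 2d·log(2Rt + 1)` — LOGARITHMIC in `Rt` (`HistoryJoinsPlacedEnd.MρP_placed_le_exp` has
`2(a₁ + d₁) + (2d + d₁)·(2c₉ + C₀κφ)`, LINEAR in it). [folklore] -/
theorem MρP_placedΩ_le_exp_natural {A : ℕ → ℕ} {a₁ d₁ : ℝ} (ha : 0 ≤ a₁) (hd : 0 ≤ d₁)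
    (hAexp : ∀ m : ℕ, (A m : ℝ) ≤ Real.exp (a₁ + d₁ * m))
    {C₀ c₉ κφ : ℝ} (hC₀ : 0 ≤ C₀) (hc₉ : 0 ≤ c₉) (hκφ : 0 ≤ κφ) (hΩ : Ω = C₀ * κφ + c₉ + 1)
    (φ : ℕ → Gen ε → ℝ) (hφ0 : ∀ t P, 0 ≤ φ t P) (G : Gen ε)
    (hlawR : ∀ (X Y : Gen ε) (e : ε), Gen.merge X Y e ∈ joins (PEv.step ∘ sh) G →
      ∀ i, i ≠ hostIdx (PEv.step ∘ sh) X Y e →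
        ∀ p ∈ Sany zone ρ c₀ (PEv.step ∘ sh) (part (PEv.step ∘ sh) (Gen.merge X Y e) i).2,
          ∀ u ∈ zone (sh e).step (part (PEv.step ∘ sh) (Gen.merge X Y e) i).2 p,
            radPΩ n L K lv tsz Ω u (sh e).step (evalA c₀ p (rootAddr (part (PEv.step ∘ sh) (Gen.merge X Y e) i).2))
                (part (PEv.step ∘ sh) (Gen.merge X Y e) i).2.rootStep ≤
              C₀ * φ (sh e).step (part (PEv.step ∘ sh) (Gen.merge X Y e) i).2 + c₉)
    (hΦ : ((joins (PEv.step ∘ sh) G).map fun X => nhsum (PEv.step ∘ sh) (φ (ftime (PEv.step ∘ sh) X)) X).sum ≤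
      κφ * bsum (fun b => (((sh b).fat : ℕ) : ℝ) + 1) G) :
    MρP (PEv.step ∘ sh) (extsup zone ρ c₀ (PEv.step ∘ sh) (radPΩ n L K lv tsz Ω)) (MρPΩ' d Ω A) G ≤
      Real.exp ((2 * a₁ + 4 * d₁ + 2 * (d : ℝ) + 2 * (d : ℝ) * Real.log (2 * (C₀ * κφ + c₉) + 1)) *
        bsum (fun b => (((sh b).fat : ℕ) : ℝ) + 1) G) := by
  set Rt : ℝ := C₀ * κφ + c₉ with hRt
  have hRt0 : 0 ≤ Rt := by rw [hRt]; positivity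
  have hΩ0 : 0 < Ω := by rw [hΩ]; positivity
  have h := MρP_placedΩ_le_exp sh lv tsz Ω zone ρ c₀ ha hd hAexp hΩ0 hRt0 hC₀ hc₉ φ hφ0 G hlawR hΦ
  refine h.trans (Real.exp_le_exp.2 (mul_le_mul_of_nonneg_right ?_ (bsum_nonneg (fun _ => by positivity) G)))
  -- `d′·(2c₉ + C₀κφ) ≤ d′·2Rt ≤ 2d + 2d₁`
  have h2R : (0 : ℝ) < 2 * Rt + 1 := by linarith
  have hΩ' : Ω = Rt + 1 := by rw [hΩ, hRt]
  have hd'0 : 0 ≤ 2 * (d : ℝ) / (2 * Rt + 1) + d₁ / Ω := by rw [hΩ']; positivity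
  have hkey : (2 * (d : ℝ) / (2 * Rt + 1) + d₁ / Ω) * (2 * Rt) ≤ 2 * (d : ℝ) + 2 * d₁ := by
    rw [hΩ', add_mul]
    have e1 : 2 * (d : ℝ) / (2 * Rt + 1) * (2 * Rt) ≤ 2 * (d : ℝ) := by
      rw [div_mul_eq_mul_div, div_le_iff₀ h2R]; nlinarith [(Nat.cast_nonneg d : (0 : ℝ) ≤ d)]
    have e2 : d₁ / (Rt + 1) * (2 * Rt) ≤ 2 * d₁ := by
      rw [div_mul_eq_mul_div, div_le_iff₀ (by linarith : (0 : ℝ) < Rt + 1)]; nlinarith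
    linarith
  have hsplit : 2 * ((a₁ + d₁ + (d : ℝ) * Real.log (2 * Rt + 1)) + (2 * (d : ℝ) / (2 * Rt + 1) + d₁ / Ω) * c₉) +
      (2 * (d : ℝ) / (2 * Rt + 1) + d₁ / Ω) * C₀ * κφ =
      2 * (a₁ + d₁ + (d : ℝ) * Real.log (2 * Rt + 1)) +
        (2 * (d : ℝ) / (2 * Rt + 1) + d₁ / Ω) * (2 * c₉ + C₀ * κφ) := by ring
  have hle : (2 * (d : ℝ) / (2 * Rt + 1) + d₁ / Ω) * (2 * c₉ + C₀ * κφ) ≤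
      (2 * (d : ℝ) / (2 * Rt + 1) + d₁ / Ω) * (2 * Rt) :=
    mul_le_mul_of_nonneg_left (by rw [hRt]; nlinarith [mul_nonneg hC₀ hκφ]) hd'0
  rw [hsplit]
  linarith

end Placed

/-! ## §4 Sanity (decided) -/

namespace Sanity

/-- with the one-template type (`tsz = 1`) the scaled size clause is `Ω·0 ≤ r`, so at every nonnegative radius the
scaled nearness is the plain cell nearness, for every `Ω` -/
example (Ω : ℝ) (u : Fin 1 → ℕ) (y : TCell 1 (1 * 2 ^ 3)) (h : nearD 1 2 3 id u 0 y 0 (5 : ℝ)) :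
    nearPΩ 1 2 3 id (fun _ : Unit => 1) Ω u 0 (y, ()) 0 5 := ⟨h, by norm_num⟩

/-- the scaled one-block count with the constant template count `A ≡ 5` is `5·NZD`, whatever `Ω` -/
example : NZPΩ' 2 3 id (7 : ℝ) (fun _ => 5) (7 : ℝ) 4 1 = HistoryJoinsSupTorus.NZD 2 3 id 7 4 1 * 5 := rfl

/-- the size clause at scale `Ω = 4`: a template of size `3` needs radius `≥ 8`, and is then read at `⌊8∕4⌋₊ + 1 = 3` -/
example : (3 : ℕ) ≤ ⌊(8 : ℝ) / 4⌋₊ + 1 := tsz_le_floor_div_add_one (4 : ℝ) (by norm_num) (by norm_num)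

end Sanity

end

end Summit.QuantumFields.BalabanUV.T4Continuum.HistoryJoinsPlacedOmega
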